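import Summits.PneNP.PneNP.Theses.KarlinRubin
import Summits.PneNP.PneNP.Theorems.KarlinRubinMonotoneSufficesMixtureErrSum
import Summits.PneNP.PneNP.Theorems.KarlinRubinMonotoneSufficesShiftableLayer
import Summits.PneNP.PneNP.Theorems.KarlinRubinMonotoneSufficesStubSubsetCollision
import Summits.PneNP.PneNP.Theorems.KarlinRubinMonotoneSufficesStubLocalThresholdSharp

/-!
# Crux `MonotoneSuffices` (stmt-PneNP-18026), line `Sketch` — mixture-shift rung in the crux's format:
# a layer of negations entered by SOME bounded-collision shift family is free
# (`stub_mixtureShiftableLayer`), and one negation of any LOCAL threshold is free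
# (`stub_localThresholdNegation`)

`stub_mixtureShiftableLayer`: let `{∧₂,∨₂,0,1}`-circuits `D n` of size `≤ s n` read the edge variables of
`Kₙ` and wires fed with `¬(g n j)(x)` (all `g n j` monotone) and strongly detect the planted `k n`-clique.
Suppose that for every `ε > 0` there is a collision budget `K` such that eventually in `n` SOME nonempty
finite family `Rs` of shift sets with `∑_{R,R'∈Rs} 2^{#(R∩R')} ≤ K · #Rs²` and some freeze pattern `b`
make `∑_{R∈Rs} Pr₀[∃ j, g n j (x ∨ 1_R) = b j] ≤ ε · #Rs`. Then a `{∧₂,∨₂,0,1}`-family of size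
`≤ s n + 2` strongly detects too (finite core `layer_good_circuit_mixture` = `stub_mixtureShiftErrSum` at
`η = ε/(K+1)` + `layer_freeze_circuit`; tolerances merged by `stub_diagonal`). This is the positive form of
the shift criterion (bounded collision ⇒ enterable ⇒ eliminable); uniformly random `r`-subsets of a slot set
`T` have collision `≤ e^{r²/#T}` (`stub_subsetCollision`), and local thresholds `[θ ≤ #(supp x ∩ T)]` are
`√#T`-sharp (`stub_localThresholdSharp`), whence

`stub_localThresholdNegation`: for ANY slot sets `T n` with `#T n → ∞` (the star of a vertex — a DEGREE
threshold; all slots — the edge count; a bipartite cut; …) one negation of `[θ n ≤ #(supp x ∩ T n)]` is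
free at size `s n + 2`, every `k`.
-/

set_option linter.dupNamespace false -- `Summit.PneNP.PneNP.…`: summit = sub-problem name (D-0017)

namespace Summit.PneNP.PneNP.Theorems.MonotoneSuffices.DensityShift

open Literature.Computability.Complexity Literature.Probability.RandomGraphs.PlantedClique Filter Finset
open scoped ENNReal

/-! ### The finite core at tolerance `1/(j+1)` -/

/-- **One good circuit at tolerance `1/(j+1)` from a bounded-collision shift family.** With
`ε = 1/(4(j+1))`, `η = ε/(K+1)`: if the layer circuit `D` is monotone of size `≤ sz`, the detector
`x ↦ D(x, ¬g⃗(x))` has error sum `≤ ε η`, and a nonempty family `Rs` with `∑ 2^{#(R∩R')} ≤ K #Rs²` and a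
freeze pattern `b` have `∑_R Pr₀[bad] ≤ ε #Rs`, then some `{∧₂,∨₂,0,1}`-circuit of size `≤ sz + 2` has error
sum `≤ 1/(j+1)`. [folklore] -/
theorem layer_good_circuit_mixture {n kn sz K j : ℕ} {κ : Type*}
    (D : Circuit ((⊤ : SimpleGraph (Fin n)).edgeSet ⊕ κ)) (g : κ → EdgeVec n → Bool)
    (hg : ∀ j, Monotone (g j)) (hDn : D.IsOver monotoneBasis01) (hsz : D.size ≤ sz)
    (Rs : Finset (Finset ((⊤ : SimpleGraph (Fin n)).edgeSet))) (hRs : Rs.Nonempty)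
    (hcoll : ((∑ R ∈ Rs, ∑ R' ∈ Rs, 2 ^ #(R ∩ R') : ℕ) : ℝ) ≤ K * (#Rs : ℝ) ^ 2) (b : κ → Bool)
    (hbad : (∑ R ∈ Rs, (erdosRenyiHalf n).toOuterMeasure
        {x | ∃ j, g j (fun e => x e || decide (e ∈ R)) = b j}) ≤
      ENNReal.ofReal (1 / (4 * ((j : ℝ) + 1))) * (#Rs : ℝ≥0∞))
    (hsm : (erdosRenyiHalf n).toOuterMeasure {x | D.eval (Sum.elim x (fun j => !(g j x))) = true} +
        (plantedCliqueDist n kn).toOuterMeasure {x | D.eval (Sum.elim x (fun j => !(g j x))) = false} ≤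
      ENNReal.ofReal (1 / (4 * ((j : ℝ) + 1)) * (1 / (4 * ((j : ℝ) + 1)) / ((K : ℝ) + 1)))) :
    ∃ M : Circuit ((⊤ : SimpleGraph (Fin n)).edgeSet), M.IsOver monotoneBasis01 ∧ M.size ≤ sz + 2 ∧
      (erdosRenyiHalf n).toOuterMeasure {x | M.eval x = true} +
          (plantedCliqueDist n kn).toOuterMeasure {x | M.eval x = false} ≤ ((j : ℝ≥0∞) + 1)⁻¹ := by
  classical
  set ε : ℝ := 1 / (4 * ((j : ℝ) + 1)) with hε
  set η : ℝ := ε / ((K : ℝ) + 1) with hη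
  have hεpos : 0 < ε := by positivity
  have hηpos : 0 < η := by positivity
  have hM0 : (#Rs : ℝ≥0∞) ≠ 0 := Nat.cast_ne_zero.2 hRs.card_pos.ne'
  have hMtop : (#Rs : ℝ≥0∞) ≠ ⊤ := ENNReal.natCast_ne_top _
  -- `F x w = D (x, w)` is monotone in the wires
  have hmono : Monotone D.eval := D.monotone_eval_of_isOver_monotoneBasis01 hDn
  have hF : ∀ x : EdgeVec n, Monotone (fun w : κ → Bool => D.eval (Sum.elim x w)) := by
    intro x w w' hww'
    refine hmono fun v => ?_
    cases v with
    | inl i => exact le_rfl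
    | inr jj => exact hww' jj
  obtain ⟨R, -, hR⟩ := stub_mixtureShiftErrSum n kn Rs (fun x w => D.eval (Sum.elim x w)) g b η hRs hF hg hηpos
  obtain ⟨M, hM, hMsize, hMev⟩ := layer_freeze_circuit D hDn R b
  refine ⟨M, hM, by omega, ?_⟩
  simp only [hMev]
  refine hR.trans ?_
  -- the three terms
  have h1 : ENNReal.ofReal η * ((∑ R ∈ Rs, ∑ R' ∈ Rs, 2 ^ #(R ∩ R') : ℕ) : ℝ≥0∞) / ((#Rs : ℝ≥0∞) ^ 2) ≤
      ENNReal.ofReal ε := by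
    have hC : ((∑ R ∈ Rs, ∑ R' ∈ Rs, 2 ^ #(R ∩ R') : ℕ) : ℝ≥0∞) ≤ (K : ℝ≥0∞) * (#Rs : ℝ≥0∞) ^ 2 := by
      have h' : ((∑ R ∈ Rs, ∑ R' ∈ Rs, 2 ^ #(R ∩ R') : ℕ) : ℝ) ≤ ((K * #Rs ^ 2 : ℕ) : ℝ) := by exact_mod_cast hcoll
      exact_mod_cast h'
    have hsq0 : (#Rs : ℝ≥0∞) ^ 2 ≠ 0 := pow_ne_zero _ hM0
    have hsqtop : (#Rs : ℝ≥0∞) ^ 2 ≠ ⊤ := ENNReal.pow_ne_top hMtop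
    calc ENNReal.ofReal η * ((∑ R ∈ Rs, ∑ R' ∈ Rs, 2 ^ #(R ∩ R') : ℕ) : ℝ≥0∞) / ((#Rs : ℝ≥0∞) ^ 2)
        ≤ ENNReal.ofReal η * ((K : ℝ≥0∞) * (#Rs : ℝ≥0∞) ^ 2) / ((#Rs : ℝ≥0∞) ^ 2) := by gcongr
      _ = ENNReal.ofReal η * (K : ℝ≥0∞) := by
          rw [← mul_assoc, ENNReal.mul_div_cancel_right hsq0 hsqtop]
      _ = ENNReal.ofReal (η * K) := by
          rw [ENNReal.ofReal_mul hηpos.le, ENNReal.ofReal_natCast]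
      _ ≤ ENNReal.ofReal ε := ENNReal.ofReal_le_ofReal (by
          rw [hη, div_mul_eq_mul_div, div_le_iff₀ (by positivity)]
          nlinarith)
  have h2 : ENNReal.ofReal (1 / η) *
      ((erdosRenyiHalf n).toOuterMeasure {x | D.eval (Sum.elim x (fun j => !(g j x))) = true} +
        (plantedCliqueDist n kn).toOuterMeasure {x | D.eval (Sum.elim x (fun j => !(g j x))) = false}) ≤
      ENNReal.ofReal ε := by
    calc _ ≤ ENNReal.ofReal (1 / η) * ENNReal.ofReal (ε * η) := mul_le_mul' le_rfl (by simpa [hε, hη] using hsm)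
      _ = ENNReal.ofReal ε := by
          rw [← ENNReal.ofReal_mul (by positivity)]
          congr 1
          field_simp
  have h3 : 2 * (∑ R' ∈ Rs, (erdosRenyiHalf n).toOuterMeasure
      {x | ∃ j, g j (fun e => x e || decide (e ∈ R')) = b j}) / (#Rs : ℝ≥0∞) ≤ 2 * ENNReal.ofReal ε := by
    calc _ ≤ 2 * (ENNReal.ofReal ε * (#Rs : ℝ≥0∞)) / (#Rs : ℝ≥0∞) := by gcongr
      _ = 2 * ENNReal.ofReal ε := by rw [← mul_assoc, ENNReal.mul_div_cancel_right hM0 hMtop]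
  calc _ ≤ ENNReal.ofReal ε + ENNReal.ofReal ε + 2 * ENNReal.ofReal ε := add_le_add (add_le_add h1 h2) h3
    _ = ENNReal.ofReal (4 * ε) := by
        rw [ENNReal.ofReal_mul (by norm_num : (0 : ℝ) ≤ 4), ENNReal.ofReal_ofNat]
        ring
    _ = ((j : ℝ≥0∞) + 1)⁻¹ := by
        rw [← layer_ofReal_one_div_succ, hε]
        congr 1
        field_simp

/-! ### The mixture layer rung -/

/-- **`stub_mixtureShiftableLayer`** (registered stub of stmt-PneNP-18026, line `Sketch`, mixture-shift
rung, crux format): **a layer of negations of monotone gates that SOME bounded-collision shift family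
enters (or that are rare) is free.** Hypotheses: `D n` over `{∧₂,∨₂,0,1}` of size `≤ s n` reading the
edges of `Kₙ` and wires `¬(g n j)(x)`, `g n j` monotone, error sum `→ 0` at clique size `k n`; and for
every `ε > 0` a collision budget `K` such that eventually some nonempty family `Rs` of shift sets with
`∑_{R,R'} 2^{#(R∩R')} ≤ K #Rs²` and some freeze pattern `b` have `∑_R Pr₀[∃ j, g n j (x ∨ 1_R) = b j] ≤ ε #Rs`.
Conclusion: a `{∧₂,∨₂,0,1}`-family of size `≤ s n + 2` with error sum `→ 0` (`layer_good_circuit_mixture`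
at every tolerance, `stub_diagonal`). [folklore] -/
theorem stub_mixtureShiftableLayer :
    ∀ (k s : ℕ → ℕ) (κ : ℕ → Type)
      (D : (n : ℕ) → Circuit ((⊤ : SimpleGraph (Fin n)).edgeSet ⊕ κ n))
      (g : (n : ℕ) → κ n → EdgeVec n → Bool),
      (∀ n j, Monotone (g n j)) →
      (∀ᶠ n : ℕ in atTop, (D n).IsOver monotoneBasis01 ∧ (D n).size ≤ s n) →
      Tendsto (fun n : ℕ =>
          (erdosRenyiHalf n).toOuterMeasure {x | (D n).eval (Sum.elim x (fun j => !(g n j x))) = true} +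
            (plantedCliqueDist n (k n)).toOuterMeasure
              {x | (D n).eval (Sum.elim x (fun j => !(g n j x))) = false}) atTop (nhds 0) →
      (∀ ε : ℝ, 0 < ε → ∃ K : ℕ, ∀ᶠ n : ℕ in atTop,
          ∃ Rs : Finset (Finset ((⊤ : SimpleGraph (Fin n)).edgeSet)), Rs.Nonempty ∧
            ((∑ R ∈ Rs, ∑ R' ∈ Rs, 2 ^ #(R ∩ R') : ℕ) : ℝ) ≤ K * (#Rs : ℝ) ^ 2 ∧
            ∃ b : κ n → Bool,
              (∑ R ∈ Rs, (erdosRenyiHalf n).toOuterMeasure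
                  {x | ∃ j, g n j (fun e => x e || decide (e ∈ R)) = b j}) ≤ ENNReal.ofReal ε * (#Rs : ℝ≥0∞)) →
      ∃ M : (n : ℕ) → Circuit ((⊤ : SimpleGraph (Fin n)).edgeSet),
        (∀ᶠ n : ℕ in atTop, (M n).IsOver monotoneBasis01 ∧ (M n).size ≤ s n + 2) ∧
        Tendsto (fun n : ℕ => (erdosRenyiHalf n).toOuterMeasure {x | (M n).eval x = true} +
            (plantedCliqueDist n (k n)).toOuterMeasure {x | (M n).eval x = false}) atTop (nhds 0) := by
  intro k s κ D g hg hD herr hshift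
  classical
  refine stub_diagonal (X := fun n => Circuit ((⊤ : SimpleGraph (Fin n)).edgeSet))
    (fun n M => M.IsOver monotoneBasis01 ∧ M.size ≤ s n + 2)
    (fun n M => (erdosRenyiHalf n).toOuterMeasure {x | M.eval x = true} +
      (plantedCliqueDist n (k n)).toOuterMeasure {x | M.eval x = false}) fun j => ?_
  -- tolerance `ε = 1/(4(j+1))`, collision budget `K`, threshold `ε η`
  have hεpos : (0 : ℝ) < 1 / (4 * ((j : ℝ) + 1)) := by positivity
  obtain ⟨K, hK⟩ := hshift _ hεpos
  have hthr : (0 : ℝ) < 1 / (4 * ((j : ℝ) + 1)) * (1 / (4 * ((j : ℝ) + 1)) / ((K : ℝ) + 1)) := by positivity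
  have hsmall := ENNReal.tendsto_nhds_zero.1 herr _ (ENNReal.ofReal_pos.2 hthr)
  let Good : ℕ → Prop := fun n => ((D n).IsOver monotoneBasis01 ∧ (D n).size ≤ s n) ∧
    ((erdosRenyiHalf n).toOuterMeasure {x | (D n).eval (Sum.elim x (fun j => !(g n j x))) = true} +
        (plantedCliqueDist n (k n)).toOuterMeasure {x | (D n).eval (Sum.elim x (fun j => !(g n j x))) = false} ≤
      ENNReal.ofReal (1 / (4 * ((j : ℝ) + 1)) * (1 / (4 * ((j : ℝ) + 1)) / ((K : ℝ) + 1)))) ∧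
    (∃ Rs : Finset (Finset ((⊤ : SimpleGraph (Fin n)).edgeSet)), Rs.Nonempty ∧
      ((∑ R ∈ Rs, ∑ R' ∈ Rs, 2 ^ #(R ∩ R') : ℕ) : ℝ) ≤ K * (#Rs : ℝ) ^ 2 ∧
      ∃ b : κ n → Bool,
        (∑ R ∈ Rs, (erdosRenyiHalf n).toOuterMeasure
            {x | ∃ j, g n j (fun e => x e || decide (e ∈ R)) = b j}) ≤
          ENNReal.ofReal (1 / (4 * ((j : ℝ) + 1))) * (#Rs : ℝ≥0∞))
  have hgood : ∀ᶠ n : ℕ in atTop, Good n := hD.and (hsmall.and hK)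
  have hex : ∀ n, Good n → ∃ M : Circuit ((⊤ : SimpleGraph (Fin n)).edgeSet),
      M.IsOver monotoneBasis01 ∧ M.size ≤ s n + 2 ∧
        (erdosRenyiHalf n).toOuterMeasure {x | M.eval x = true} +
          (plantedCliqueDist n (k n)).toOuterMeasure {x | M.eval x = false} ≤ ((j : ℝ≥0∞) + 1)⁻¹ := by
    rintro n ⟨⟨hDn, hsz⟩, hsm, Rs, hRs, hcoll, b, hb⟩
    exact layer_good_circuit_mixture (D n) (g n) (hg n) hDn hsz Rs hRs hcoll b hb hsm
  refine ⟨fun n => if h : Good n then (hex n h).choose else Circuit.const _ false, ?_⟩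
  filter_upwards [hgood] with n hn
  rw [dif_pos hn]
  obtain ⟨h1, h2, h3⟩ := (hex n hn).choose_spec
  exact ⟨⟨h1, h2⟩, h3⟩

/-! ### One negation of a local threshold is free -/

/-- Local threshold gates `[θ ≤ #(supp x ∩ T)]` are monotone. [folklore] -/
theorem layer_localThreshold_monotone {n : ℕ} (T : Finset ((⊤ : SimpleGraph (Fin n)).edgeSet)) (θ : ℕ) :
    Monotone (fun x : EdgeVec n => decide (θ ≤ #(T.filter fun e => x e = true))) := by
  intro x y hxy
  have hsub : (T.filter fun e => x e = true) ⊆ (T.filter fun e => y e = true) := fun e he => by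
    simp only [mem_filter] at he ⊢
    have h := hxy e
    rw [he.2] at h
    exact ⟨he.1, Bool.eq_true_of_true_le h⟩
  have hcard := card_le_card hsub
  show decide _ ≤ decide _
  by_cases h : θ ≤ #(T.filter fun e => x e = true)
  · rw [decide_eq_true h, decide_eq_true (h.trans hcard)]
  · rw [decide_eq_false h]; exact Bool.false_le _

/-- **`stub_localThresholdNegation`** (registered stub of stmt-PneNP-18026, line `Sketch`, mixture-shift
rung, crux format): **one negation of ANY local threshold gate is free on the planted pair.** For slot sets
`T n` with `#T n → ∞` and thresholds `θ n`: if `{∧₂,∨₂,0,1}`-circuits `D n` of size `≤ s n`, reading the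
edges of `Kₙ` and ONE wire carrying `¬[θ n ≤ #(supp x ∩ T n)]`, strongly detect the planted `k n`-clique,
then some `{∧₂,∨₂,0,1}`-family of size `≤ s n + 2` does (every `k`). The shift family is the uniform
`r`-subsets of `T n`, `r = C ⌊√#T n⌋` (collision `≤ e^{C²}`, `stub_subsetCollision`) when the threshold is
forced, the trivial family `{∅}` when it is rare (`stub_localThresholdSharp`). Degree of a vertex = star,
edge count = all slots. [folklore] -/
theorem stub_localThresholdNegation :
    ∀ (k s θ : ℕ → ℕ) (T : (n : ℕ) → Finset ((⊤ : SimpleGraph (Fin n)).edgeSet))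
      (D : (n : ℕ) → Circuit ((⊤ : SimpleGraph (Fin n)).edgeSet ⊕ Unit)),
      Tendsto (fun n => #(T n)) atTop atTop →
      (∀ᶠ n : ℕ in atTop, (D n).IsOver monotoneBasis01 ∧ (D n).size ≤ s n) →
      Tendsto (fun n : ℕ =>
          (erdosRenyiHalf n).toOuterMeasure {x | (D n).eval
              (Sum.elim x (fun _ => !decide (θ n ≤ #((T n).filter fun e => x e = true)))) = true} +
            (plantedCliqueDist n (k n)).toOuterMeasure {x | (D n).eval
              (Sum.elim x (fun _ => !decide (θ n ≤ #((T n).filter fun e => x e = true)))) = false})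
        atTop (nhds 0) →
      ∃ M : (n : ℕ) → Circuit ((⊤ : SimpleGraph (Fin n)).edgeSet),
        (∀ᶠ n : ℕ in atTop, (M n).IsOver monotoneBasis01 ∧ (M n).size ≤ s n + 2) ∧
        Tendsto (fun n : ℕ => (erdosRenyiHalf n).toOuterMeasure {x | (M n).eval x = true} +
            (plantedCliqueDist n (k n)).toOuterMeasure {x | (M n).eval x = false}) atTop (nhds 0) := by
  intro k s θ T D hT hD herr
  classical
  refine stub_mixtureShiftableLayer k s (fun _ => Unit) D
    (fun n _ x => decide (θ n ≤ #((T n).filter fun e => x e = true)))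
    (fun n _ => layer_localThreshold_monotone (T n) (θ n)) hD herr fun ε hε => ?_
  obtain ⟨C, n₀, hCn₀⟩ := stub_localThresholdSharp ε hε
  -- collision budget: `⌈e^{C²}⌉`
  refine ⟨⌈Real.exp ((C : ℝ) ^ 2)⌉₊, ?_⟩
  have hK1 : (1 : ℝ) ≤ ⌈Real.exp ((C : ℝ) ^ 2)⌉₊ :=
    le_trans (by exact_mod_cast Real.one_le_exp (by positivity)) (Nat.le_ceil _)
  have hcardE : ∀ n, Fintype.card ((⊤ : SimpleGraph (Fin n)).edgeSet) = n.choose 2 := card_edgeSet_top_fin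
  filter_upwards [hT.eventually_ge_atTop (max n₀ (C ^ 2 + 1))] with n hn
  have hn₀ : n₀ ≤ #(T n) := le_trans (le_max_left _ _) hn
  have hC2 : C ^ 2 + 1 ≤ #(T n) := le_trans (le_max_right _ _) hn
  have hTpos : 0 < #(T n) := by omega
  rcases hCn₀ (T n) (θ n) hn₀ with hA | hB
  · -- forced by the `C √#T`-shifts inside `T n`: freeze the wire `¬g` to `0`
    set r := C * Nat.sqrt #(T n) with hr
    have hrT : r ≤ #(T n) := by
      have h1 : C ≤ Nat.sqrt #(T n) := Nat.le_sqrt.2 (by nlinarith)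
      calc r = C * Nat.sqrt #(T n) := hr
        _ ≤ Nat.sqrt #(T n) * Nat.sqrt #(T n) := Nat.mul_le_mul_right _ h1
        _ ≤ #(T n) := Nat.sqrt_le #(T n)
    refine ⟨(T n).powersetCard r, powersetCard_nonempty.2 hrT, ?_, fun _ => false, ?_⟩
    · -- collision `≤ C(m,r)² e^{r²/m} ≤ ⌈e^{C²}⌉ · #Rs²`
      have hcoll := stub_subsetCollision (T n) r hTpos
      have hexp : Real.exp ((r : ℝ) ^ 2 / #(T n)) ≤ ⌈Real.exp ((C : ℝ) ^ 2)⌉₊ := by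
        refine le_trans (Real.exp_le_exp.2 ?_) (Nat.le_ceil _)
        rw [div_le_iff₀ (by exact_mod_cast hTpos), hr]
        push_cast
        have hs : ((Nat.sqrt #(T n) : ℕ) : ℝ) ^ 2 ≤ #(T n) := by exact_mod_cast Nat.sqrt_le' #(T n)
        nlinarith [sq_nonneg (C : ℝ)]
      rw [card_powersetCard]
      push_cast at hcoll ⊢
      calc ∑ R ∈ (T n).powersetCard r, ∑ R' ∈ (T n).powersetCard r, (2 : ℝ) ^ #(R ∩ R')
          ≤ ((#(T n)).choose r : ℝ) ^ 2 * Real.exp ((r : ℝ) ^ 2 / #(T n)) := hcoll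
        _ ≤ ((#(T n)).choose r : ℝ) ^ 2 * ⌈Real.exp ((C : ℝ) ^ 2)⌉₊ := by gcongr
        _ = _ := by ring
    · calc ∑ R ∈ (T n).powersetCard r, (erdosRenyiHalf n).toOuterMeasure
            {x | ∃ _ : Unit, decide (θ n ≤ #((T n).filter fun e => (x e || decide (e ∈ R)) = true)) = false}
          ≤ ∑ _R ∈ (T n).powersetCard r, ENNReal.ofReal ε := by
            refine sum_le_sum fun R hR => ?_
            have hset : {x : EdgeVec n | ∃ _ : Unit,
                decide (θ n ≤ #((T n).filter fun e => (x e || decide (e ∈ R)) = true)) = false} =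
                {x | #((T n).filter fun e => (x e || decide (e ∈ R)) = true) < θ n} := Set.ext fun x => by
              simp only [Set.mem_setOf_eq, exists_const, decide_eq_false_iff_not, not_le]
            rw [hset]
            refine thresholdSharp_erdosRenyiHalf_le_ofReal _ hε.le ?_
            have h := hA R hR
            rw [hcardE n] at h
            simpa [mul_comm] using h
        _ = ENNReal.ofReal ε * (#((T n).powersetCard r) : ℝ≥0∞) := by
            rw [sum_const, nsmul_eq_mul, mul_comm]
  · -- rare: no shift (the family `{∅}`), freeze the wire `¬g` to `1`
    refine ⟨{∅}, singleton_nonempty _, ?_, fun _ => true, ?_⟩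
    · simp only [sum_singleton, inter_self, card_empty, pow_zero, card_singleton, Nat.cast_one, one_pow,
        mul_one]
      exact_mod_cast hK1
    · rw [sum_singleton, card_singleton, Nat.cast_one, mul_one]
      have hset : {x : EdgeVec n | ∃ _ : Unit,
          decide (θ n ≤ #((T n).filter fun e => (x e || decide (e ∈ (∅ : Finset _))) = true)) = true} =
          {x | θ n ≤ #((T n).filter fun e => x e = true)} := Set.ext fun x => by
        simp only [Set.mem_setOf_eq, exists_const, decide_eq_true_eq, Finset.notMem_empty, decide_false,
          Bool.or_false]
      rw [hset]
      refine thresholdSharp_erdosRenyiHalf_le_ofReal _ hε.le ?_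
      have h := hB
      rw [hcardE n] at h
      simpa [mul_comm] using h

end Summit.PneNP.PneNP.Theorems.MonotoneSuffices.DensityShift
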